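import Literature.AlgebraicGeometry.Motives.FaltingsAbelian
import Literature.AlgebraicGeometry.Motives.FaltingsEC
import Literature.AlgebraicGeometry.Motives.FaltingsECIsogenyProofs
import Literature.NumberTheory.EllipticCurves.AbelianVarietyBridge
import HarnessLib

/-!
# Faltings' Korollar 1 for elliptic curves, reduced to the abelian-variety statement

D-0014 keeps `Literature/` sorry-free by stating cited results as named facts. This sibling of
`Literature.AlgebraicGeometry.Motives.FaltingsEC` and
`Literature.AlgebraicGeometry.Motives.FaltingsAbelian` proves the elliptic-curve named
facts

* `Literature.Hodge.mem_span_range_tateModule_map_of_equivariant W W' ℓ` (surjectivity of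
  `Hom_K(E, E') ⊗ ℤ_ℓ → Hom_{Γ_K}(T_ℓ E, T_ℓ E')` for elliptic curves over a number field;
  Faltings 1983, Satz 4 / Korollar 1) and
* `Literature.Hodge.isIsogenous_iff_exists_tateModule_hom_ne_zero W W' ℓ` (Faltings' isogeny
  criterion, Korollar 2 for elliptic curves)

**from** the abelian-variety statement `Literature.Hodge.faltings_tate_bijective A A' ℓ` (hodge.S27;
Faltings 1983, §5, Satz 4 / Korollar 1, for abelian varieties `A, A'` over the number field `K`:
the Tate map `ℤ_ℓ ⊗ Hom_K(A, A') → Hom_{Γ_K}(T_ℓ A, T_ℓ A')` of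
`Literature.NumberTheory.DiophantineGeometry.AVIsogenyTate` is bijective) and
explicit *bridge data* identifying the Weierstrass curves `W, W'` with the abelian varieties
`A, A'`:

* `eW : A.geomPoints ≃+ W.geomPoints`, `eW' : A'.geomPoints ≃+ W'.geomPoints` — additive
  isomorphisms `A(K̄) ≅ E(K̄)`, `A'(K̄) ≅ E'(K̄)` commuting with `Γ_K` (`heW`, `heW'`);
* `hHom` — every non-zero `K`-homomorphism `f : A ⟶ A'` acts on points, after transport, as an
  isogeny `φ : E → E'` of Weierstrass curves (`φ (eW P) = eW' (f P)`).

For an elliptic curve `E/K` given by `W` such data exist (the smooth projective model of `W`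
with its chord–tangent group law is a one-dimensional abelian variety whose `K̄`-points are
`E(K̄)`, and a non-zero homomorphism of elliptic curves is an isogeny: Silverman, *AEC*,
III.3.1 (elliptic curves = smooth Weierstrass cubics), III.3.6 (the group law is a morphism),
III.4.8 (isogenies are homomorphisms)), but the construction of a Weierstrass
cubic as a `K`-group scheme is not available in Mathlib, so the bridge enters as hypotheses and
no `_holds` theorem is asserted here. What this file settles is the `ℓ`-adic transport: with the
bridge, the elliptic-curve Korollar 1 **is** the case `dim = 1` of the abelian-variety
Korollar 1.

The same bridge data are bundled as the hypothesis structure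
`WeierstrassCurve.AbelianVarietyBridge W W'`
(`Literature.NumberTheory.EllipticCurves.AbelianVarietyBridge`), whose existence for elliptic
`W, W'` over a perfect field is the named fact `WeierstrassCurve.nonempty_abelianVarietyBridge`
(elliptic curves are abelian varieties: Silverman, *AEC*, III.3.1(c), III.3.6, III.4.8;
Shatz 1986, §2). The final section restates the two reductions with a bridge `B` in place of the
five hypotheses (`…_of_bridge`) and then from the two named facts alone
(`…_of_nonempty_abelianVarietyBridge`: `nonempty_abelianVarietyBridge W W'` and
`faltings_tate_bijective A A' ℓ` for all abelian varieties `A, A'` over `K`), which is the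
complete reduction of the elliptic-curve facts to named facts of the tree: hodge.S27 and
"elliptic curves are abelian varieties".

## The argument

Given a `Γ_K`-equivariant `g : T_ℓ E → T_ℓ E'`, the transported map
`g' = T_ℓ(eW'⁻¹) ∘ g ∘ T_ℓ(eW) : T_ℓ A → T_ℓ A'` is `Γ_K`-equivariant (`T_ℓ` of an equivariant
map is equivariant), so by Korollar 1
(`Literature.AlgebraicGeometry.Motives.mem_span_range_tateModuleMap_of_faltings_tate_bijective`) it lies in the
`ℤ_ℓ`-span of the `T_ℓ f`, `f ∈ Hom_K(A, A')`. Transporting back,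
`g = T_ℓ(eW') ∘ g' ∘ T_ℓ(eW⁻¹)` lies in the span of the `T_ℓ(eW') ∘ T_ℓ f ∘ T_ℓ(eW⁻¹)`, and for
`f ≠ 0` this composite is `T_ℓ φ` for the isogeny `φ` provided by `hHom` (functoriality of
`T_ℓ`), while for `f = 0` it vanishes.

## References

* [Faltings1983Endlichkeit] G. Faltings, Invent. Math. 73 (1983), §5, Satz 4, Korollar 1, 2.
* [SilvermanAEC2009] J. H. Silverman, *The Arithmetic of Elliptic Curves*, 2nd ed., III.3.1,
  III.3.6, III.4.8, III.7.4, III.7.7.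
* [Shatz1986GroupSchemes] S. S. Shatz, *Group schemes, formal groups, and p-divisible groups*,
  in *Arithmetic Geometry* (Storrs 1984), Springer 1986, §2 (the plane cubic as a group scheme,
  an abelian variety of dimension 1).
-/

noncomputable section

universe u

namespace Literature.AlgebraicGeometry.Motives

open WeierstrassCurve

variable {K : Type u} [Field K] {W W' : WeierstrassCurve K} {A A' : AbelianVariety K}
variable (ℓ : ℕ) [Fact ℓ.Prime]

/-- `T_ℓ` of a `Γ_K`-equivariant additive map between `Γ_K`-modules is `Γ_K`-equivariant
(componentwise). Silverman, *AEC*, III.§7. [folklore] -/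
theorem tateModule_map_smul_of_equivariant {M N : Type u} [AddCommGroup M] [AddCommGroup N]
    [DistribMulAction (Field.absoluteGaloisGroup K) M]
    [DistribMulAction (Field.absoluteGaloisGroup K) N]
    (e : M →+ N) (he : ∀ (σ : Field.absoluteGaloisGroup K) (P : M), e (σ • P) = σ • e P)
    (σ : Field.absoluteGaloisGroup K) (x : Literature.NumberTheory.EllipticCurves.TateModule M ℓ) :
    Literature.NumberTheory.EllipticCurves.TateModule.map ℓ e (σ • x) = σ • Literature.NumberTheory.EllipticCurves.TateModule.map ℓ e x :=
  Literature.NumberTheory.EllipticCurves.TateModule.ext fun _ ↦ he σ _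

/-- `T_ℓ(e⁻¹) ∘ T_ℓ(e) = id` for an additive isomorphism `e` (functoriality of `T_ℓ`). [folklore] -/
theorem tateModule_map_symm_comp {M N : Type u} [AddCommGroup M] [AddCommGroup N] (e : M ≃+ N) :
    (Literature.NumberTheory.EllipticCurves.TateModule.map ℓ (e.symm : N →+ M)).comp (Literature.NumberTheory.EllipticCurves.TateModule.map ℓ (e : M →+ N)) = LinearMap.id := by
  have : (e.symm : N →+ M).comp (e : M →+ N) = AddMonoidHom.id M :=
    AddMonoidHom.ext e.symm_apply_apply
  rw [← Literature.NumberTheory.EllipticCurves.TateModule.map_comp, this, Literature.NumberTheory.EllipticCurves.TateModule.map_id]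

/-- `T_ℓ(e) ∘ T_ℓ(e⁻¹) = id` for an additive isomorphism `e` (functoriality of `T_ℓ`). [folklore] -/
theorem tateModule_map_comp_symm {M N : Type u} [AddCommGroup M] [AddCommGroup N] (e : M ≃+ N) :
    (Literature.NumberTheory.EllipticCurves.TateModule.map ℓ (e : M →+ N)).comp (Literature.NumberTheory.EllipticCurves.TateModule.map ℓ (e.symm : N →+ M)) = LinearMap.id :=
  tateModule_map_symm_comp ℓ e.symm

/-- **Reduction of the elliptic-curve Korollar 1 to the abelian-variety Korollar 1.** Let
`W, W'` be Weierstrass curves and `A, A'` abelian varieties over a number field `K`, with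
`Γ_K`-equivariant additive isomorphisms `eW : A(K̄) ≅ E(K̄)`, `eW' : A'(K̄) ≅ E'(K̄)` such that
every non-zero `f ∈ Hom_K(A, A')` corresponds to an isogeny `E → E'` (`hHom`). If
`Hom_K(A, A') ⊗ ℤ_ℓ → Hom_{Γ_K}(T_ℓ A, T_ℓ A')` is bijective (`faltings_tate_bijective A A' ℓ`,
Faltings 1983, Korollar 1, hypothesis `h`), then every `Γ_K`-equivariant `ℤ_ℓ`-linear
`g : T_ℓ E → T_ℓ E'` lies in the `ℤ_ℓ`-span of the maps `T_ℓ φ`, `φ : E → E'` an isogeny over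
`K`. Faltings, Invent. Math. 73
(1983), §5, Korollar 1; Silverman, *AEC*, III.7.7. [folklore] -/
theorem mem_span_range_tateModule_map_of_abelianVariety
    (eW : A.geomPoints ≃+ W.geomPoints)
    (heW : ∀ (σ : Field.absoluteGaloisGroup K) (P : A.geomPoints), eW (σ • P) = σ • eW P)
    (eW' : A'.geomPoints ≃+ W'.geomPoints)
    (heW' : ∀ (σ : Field.absoluteGaloisGroup K) (P : A'.geomPoints), eW' (σ • P) = σ • eW' P)
    (hHom : ∀ f : A ⟶ A', f ≠ 0 →
      ∃ φ : Isogeny W W', ∀ P : A.geomPoints, φ (eW P) = eW' (AbelianVariety.Hom.geomPointsMap f P))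
    (h : faltings_tate_bijective A A' ℓ) [NumberField K]
    (g : W.tateModule ℓ →ₗ[ℤ_[ℓ]] W'.tateModule ℓ)
    (hg : ∀ (σ : Field.absoluteGaloisGroup K) (x : W.tateModule ℓ), g (σ • x) = σ • g x) :
    g ∈ Submodule.span ℤ_[ℓ]
      (Set.range fun φ : Isogeny W W' ↦ Literature.NumberTheory.EllipticCurves.TateModule.map ℓ φ.toAddMonoidHom) := by
  classical
  -- the four transport maps
  set TW : A.tateModule ℓ →ₗ[ℤ_[ℓ]] W.tateModule ℓ :=
    Literature.NumberTheory.EllipticCurves.TateModule.map ℓ (eW : A.geomPoints →+ W.geomPoints) with hTW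
  set TWi : W.tateModule ℓ →ₗ[ℤ_[ℓ]] A.tateModule ℓ :=
    Literature.NumberTheory.EllipticCurves.TateModule.map ℓ (eW.symm : W.geomPoints →+ A.geomPoints) with hTWi
  set TW' : A'.tateModule ℓ →ₗ[ℤ_[ℓ]] W'.tateModule ℓ :=
    Literature.NumberTheory.EllipticCurves.TateModule.map ℓ (eW' : A'.geomPoints →+ W'.geomPoints) with hTW'
  set TWi' : W'.tateModule ℓ →ₗ[ℤ_[ℓ]] A'.tateModule ℓ :=
    Literature.NumberTheory.EllipticCurves.TateModule.map ℓ (eW'.symm : W'.geomPoints →+ A'.geomPoints) with hTWi'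
  have hWW : TW.comp TWi = LinearMap.id := tateModule_map_comp_symm ℓ eW
  have hWW' : TW'.comp TWi' = LinearMap.id := tateModule_map_comp_symm ℓ eW'
  have hiW' : TWi'.comp TW' = LinearMap.id := tateModule_map_symm_comp ℓ eW'
  -- the transported map is equivariant
  set g' : A.tateModule ℓ →ₗ[ℤ_[ℓ]] A'.tateModule ℓ := (TWi'.comp g).comp TW with hg'
  have heWi' : ∀ (σ : Field.absoluteGaloisGroup K) (Q : W'.geomPoints),
      eW'.symm (σ • Q) = σ • eW'.symm Q := fun σ Q ↦ by
    apply eW'.injective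
    rw [heW', eW'.apply_symm_apply, eW'.apply_symm_apply]
  have hg'eq : ∀ (σ : Field.absoluteGaloisGroup K) (x : A.tateModule ℓ), g' (σ • x) = σ • g' x := by
    intro σ x
    simp only [hg', LinearMap.comp_apply]
    rw [hTW, tateModule_map_smul_of_equivariant ℓ (eW : A.geomPoints →+ W.geomPoints) heW, hg,
      hTWi', tateModule_map_smul_of_equivariant ℓ (eW'.symm : W'.geomPoints →+ A'.geomPoints) heWi']
  -- Korollar 1 for (A, A')
  have hmem := mem_span_range_tateModuleMap_of_faltings_tate_bijective ℓ h g' hg'eq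
  -- transport back: g = TW' ∘ g' ∘ TWi
  have hgg : g = (TW'.comp g').comp TWi := by
    rw [hg', ← LinearMap.comp_assoc, ← LinearMap.comp_assoc, hWW', LinearMap.id_comp,
      LinearMap.comp_assoc, hWW, LinearMap.comp_id]
  rw [hgg]
  refine Submodule.span_induction ?_ ?_ ?_ ?_ hmem
  · rintro _ ⟨f, rfl⟩
    by_cases hf : f = 0
    · rw [hf, AbelianVariety.tateModuleMap_zero ℓ, LinearMap.comp_zero, LinearMap.zero_comp]
      exact zero_mem _
    · obtain ⟨φ, hφ⟩ := hHom f hf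
      refine Submodule.subset_span ⟨φ, ?_⟩
      -- T φ = TW' ∘ T f ∘ TWi, from φ ∘ eW = eW' ∘ f
      have key : (Literature.NumberTheory.EllipticCurves.TateModule.map ℓ φ.toAddMonoidHom).comp TW =
          TW'.comp (AbelianVariety.tateModuleMap ℓ f) := by
        rw [hTW, hTW', AbelianVariety.tateModuleMap, ← Literature.NumberTheory.EllipticCurves.TateModule.map_comp,
          ← Literature.NumberTheory.EllipticCurves.TateModule.map_comp]
        congr 1
        ext P
        exact hφ P
      calc Literature.NumberTheory.EllipticCurves.TateModule.map ℓ φ.toAddMonoidHom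
          = ((Literature.NumberTheory.EllipticCurves.TateModule.map ℓ φ.toAddMonoidHom).comp TW).comp TWi := by
            rw [LinearMap.comp_assoc, hWW, LinearMap.comp_id]
        _ = (TW'.comp (AbelianVariety.tateModuleMap ℓ f)).comp TWi := by rw [key]
  · rw [LinearMap.comp_zero, LinearMap.zero_comp]; exact zero_mem _
  · intro u v _ _ hu hv
    rw [LinearMap.comp_add, LinearMap.add_comp]
    exact add_mem hu hv
  · intro c u _ hu
    rw [LinearMap.comp_smul, LinearMap.smul_comp]
    exact Submodule.smul_mem _ c hu


variable (W W') in
/-- The named fact `Literature.Hodge.mem_span_range_tateModule_map_of_equivariant W W' ℓ` (Faltings'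
Satz 4 / Korollar 1 for elliptic curves) follows from the abelian-variety Korollar 1 for a pair
of abelian varieties `A, A'` bridged to `W, W'` as above. [folklore] -/
theorem mem_span_range_tateModule_map_of_equivariant_of_faltings_tate_bijective
    (eW : A.geomPoints ≃+ W.geomPoints)
    (heW : ∀ (σ : Field.absoluteGaloisGroup K) (P : A.geomPoints), eW (σ • P) = σ • eW P)
    (eW' : A'.geomPoints ≃+ W'.geomPoints)
    (heW' : ∀ (σ : Field.absoluteGaloisGroup K) (P : A'.geomPoints), eW' (σ • P) = σ • eW' P)
    (hHom : ∀ f : A ⟶ A', f ≠ 0 →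
      ∃ φ : Isogeny W W', ∀ P : A.geomPoints, φ (eW P) = eW' (AbelianVariety.Hom.geomPointsMap f P))
    (h : faltings_tate_bijective A A' ℓ) :
    mem_span_range_tateModule_map_of_equivariant W W' ℓ :=
  fun f hf ↦ mem_span_range_tateModule_map_of_abelianVariety ℓ eW heW eW' heW' hHom h f hf

variable (W W') in
/-- **Faltings' isogeny criterion for elliptic curves from the abelian-variety Korollar 1**:
with bridge data as above, `Literature.Hodge.isIsogenous_iff_exists_tateModule_hom_ne_zero W W' ℓ`
(two elliptic curves over a number field are isogenous iff there is a non-zero `Γ_K`-equivariant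
`T_ℓ E → T_ℓ E'`) follows from `faltings_tate_bijective A A' ℓ`, via
`isIsogenous_iff_exists_tateModule_hom_ne_zero_of_satz4` (sibling `FaltingsECIsogenyProofs`).
Faltings 1983, §5, Korollar 2; Silverman, *AEC*, III.7.7. [folklore] -/
theorem isIsogenous_iff_exists_tateModule_hom_ne_zero_of_faltings_tate_bijective
    (eW : A.geomPoints ≃+ W.geomPoints)
    (heW : ∀ (σ : Field.absoluteGaloisGroup K) (P : A.geomPoints), eW (σ • P) = σ • eW P)
    (eW' : A'.geomPoints ≃+ W'.geomPoints)
    (heW' : ∀ (σ : Field.absoluteGaloisGroup K) (P : A'.geomPoints), eW' (σ • P) = σ • eW' P)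
    (hHom : ∀ f : A ⟶ A', f ≠ 0 →
      ∃ φ : Isogeny W W', ∀ P : A.geomPoints, φ (eW P) = eW' (AbelianVariety.Hom.geomPointsMap f P))
    (h : faltings_tate_bijective A A' ℓ) :
    isIsogenous_iff_exists_tateModule_hom_ne_zero W W' ℓ :=
  isIsogenous_iff_exists_tateModule_hom_ne_zero_of_satz4 W W' ℓ
    (mem_span_range_tateModule_map_of_equivariant_of_faltings_tate_bijective W W' ℓ eW heW eW' heW'
      hHom h)

/-! ## From bridge data, and from the two named facts

`WeierstrassCurve.AbelianVarietyBridge W W'` bundles `(A, A', eW, heW, eW', heW', hHom)`;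
`WeierstrassCurve.nonempty_abelianVarietyBridge W W'` asserts its existence for elliptic `W, W'`
over a perfect field (a number field is perfect: `CharZero K`). -/

variable (W W') in
/-- Faltings' Satz 4 / Korollar 1 for elliptic curves from **bridge data**
`B : AbelianVarietyBridge W W'` (`Literature.NumberTheory.EllipticCurves.AbelianVarietyBridge`:
abelian varieties `B.A, B.A'` over `K` with `Γ_K`-equivariant identifications
`B.A(K̄) ≅ E(K̄)`, `B.A'(K̄) ≅ E'(K̄)` under which non-zero homomorphisms are isogenies) and
hodge.S27 for the pair `(B.A, B.A')` (`faltings_tate_bijective`, Faltings 1983, §5, Korollar 1):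
a repackaging of `mem_span_range_tateModule_map_of_equivariant_of_faltings_tate_bijective`.
[folklore] -/
theorem mem_span_range_tateModule_map_of_equivariant_of_bridge (B : AbelianVarietyBridge W W')
    (h : faltings_tate_bijective B.A B.A' ℓ) :
    mem_span_range_tateModule_map_of_equivariant W W' ℓ :=
  mem_span_range_tateModule_map_of_equivariant_of_faltings_tate_bijective W W' ℓ B.e B.e_smul
    B.e' B.e'_smul B.exists_isogeny h

variable (W W') in
/-- Faltings' isogeny criterion for elliptic curves (Korollar 2) from bridge data
`B : AbelianVarietyBridge W W'` and hodge.S27 for `(B.A, B.A')`: a repackaging of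
`isIsogenous_iff_exists_tateModule_hom_ne_zero_of_faltings_tate_bijective`.
Faltings 1983, §5, Korollar 2. [folklore] -/
theorem isIsogenous_iff_exists_tateModule_hom_ne_zero_of_bridge (B : AbelianVarietyBridge W W')
    (h : faltings_tate_bijective B.A B.A' ℓ) :
    isIsogenous_iff_exists_tateModule_hom_ne_zero W W' ℓ :=
  isIsogenous_iff_exists_tateModule_hom_ne_zero_of_faltings_tate_bijective W W' ℓ B.e B.e_smul
    B.e' B.e'_smul B.exists_isogeny h

variable (W W') in
/-- **Faltings' Satz 4 / Korollar 1 for elliptic curves over a number field, from the two named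
facts it rests on**: existence of bridge data for elliptic `W, W'`
(`WeierstrassCurve.nonempty_abelianVarietyBridge W W'`: elliptic curves are abelian varieties;
a number field is perfect) and hodge.S27 for every pair of abelian varieties over `K`
(`faltings_tate_bijective`, Faltings 1983, §5, Satz 4 / Korollar 1). [folklore] -/
theorem mem_span_range_tateModule_map_of_equivariant_of_nonempty_abelianVarietyBridge
    (hB : nonempty_abelianVarietyBridge W W')
    (hF : ∀ A A' : AbelianVariety K, faltings_tate_bijective A A' ℓ) :
    mem_span_range_tateModule_map_of_equivariant W W' ℓ := by
  intro _ _ _ f hf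
  obtain ⟨B⟩ := (nonempty_abelianVarietyBridge_iff W W').1 hB
  exact mem_span_range_tateModule_map_of_equivariant_of_bridge W W' ℓ B (hF B.A B.A') f hf

variable (W W') in
/-- **Faltings' isogeny criterion for elliptic curves over a number field, from the two named
facts it rests on**: `Literature.Hodge.isIsogenous_iff_exists_tateModule_hom_ne_zero W W' ℓ` (two
elliptic curves over a number field `K` are isogenous over `K` iff there is a non-zero
`Γ_K`-equivariant `ℤ_ℓ`-linear map `T_ℓ E → T_ℓ E'`; Faltings 1983, §5, Korollar 2) follows from
the existence of bridge data for elliptic `W, W'`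
(`WeierstrassCurve.nonempty_abelianVarietyBridge W W'`: elliptic curves are abelian varieties;
a number field is perfect) and hodge.S27 for every pair of abelian varieties over `K`
(`faltings_tate_bijective`, Faltings 1983, §5, Satz 4 / Korollar 1). This is the complete
reduction of the elliptic-curve fact to named facts of the tree. [folklore] -/
theorem isIsogenous_iff_exists_tateModule_hom_ne_zero_of_nonempty_abelianVarietyBridge
    (hB : nonempty_abelianVarietyBridge W W')
    (hF : ∀ A A' : AbelianVariety K, faltings_tate_bijective A A' ℓ) :
    isIsogenous_iff_exists_tateModule_hom_ne_zero W W' ℓ := by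
  intro _ _ _
  obtain ⟨B⟩ := (nonempty_abelianVarietyBridge_iff W W').1 hB
  exact isIsogenous_iff_exists_tateModule_hom_ne_zero_of_bridge W W' ℓ B (hF B.A B.A')

end Literature.AlgebraicGeometry.Motives
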